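import Summits.QuantumFields.YangMills.Theorems.UnitScaleTiltProp7SliceBoundBookkeeping
import Summits.QuantumFields.YangMills.Theorems.UnitScaleTiltProp7TranslatedTubeFilling
import Summits.QuantumFields.YangMills.Theorems.UnitScaleTiltProp8ChartTransport
import Literature.MathematicalPhysics.QuantumFieldTheory.Balaban1983to89.TorusLimitAxioms
import HarnessLib

/-!
# `UnitScaleTiltProp7OneStepL2BoundsT3` — (I3′) PLAN B, FILE P4-B: the FIVE ONE-STEP `ℓ²` ROWS of «SliceBoundOneStep» (tube contraction, comb mean, centre sampling, coarse gradient,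
# CURL THROUGH ONE TUBE STEP) + translation invariance of the curl energy; every constant a power of `L` (level-, volume- and `K`-free)
(route `UnitScaleTilt`, crux K1 «MinimiserStabilityRegPr» stmt-QuantumFields-19200; route-R E′ (A′)-comb; ★★OWNER RULING №18 (2) «COMB-FLAT-COERCIVITY := FILE B ∘ τ + isometry transfer + (I3′)»;
(I3′) organisation of record = px22 g5 PLAN B `LOCATE-I3-ONESTEP-px22g5.md` ac2baf06 adopted by the (I3′) pen w4 g8 2026-08-29T05:54:26Z (P1 w4 · P2 px21 · P3 px22 · **P4 px6**); P3∕P4 interface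
= px22 g5 06:00:53Z «(A,Φ) SPLIT `Πσ_{<j} − Πγ_{<j} = A_j + d_jΦ_j`, `A_{j+1} = t_j(A_j) + e_j(G_j)`, `Φ_{j+1} = Φ_j∘emb − λ_j(A_j)`; P4 = a scalar recursion on GLOBAL `ℓ²` norms»; this file =
rows (B1)–(B6) of px6 g6's `LOCATE-P4-SLICEBOUND-ONESTEP-px6g6.md` 3fd15d77 as re-aimed 06:1xZ; def-free, count-neutral).  Cell `ym3-torus` (HUMAN RULING D-0037, YM ladder rung R3 — YM₃ on T³ is a
rung, not d = 4, not infinite volume, not a mass gap, not Clay), width seat `ym3-torus-px6` (gen 6).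
THE PRINT.  [Balaban1984PropagatorsI] (1.11) p. 19: `(QA)(c) = Σ_{x∈B(c₋)} L^{−(d+1)} A([x, x(c)])`, (1.16)–(1.18) p. 20: `Q_k` is the `k`-fold composition; [Balaban1985Averaging] (62) p. 28 ∕ (124)–(125)
p. 36: the linearised (0.4) average is `L·Q − d∘λ̄` (tree ✓`linAvg_eq_bondAvg_sub_grad_combMean`); [Balaban1985BackgroundPropagators] Thm 3.11 p. 416 at the flat member needs the slice bound (I3′)
`Σ_c|δQ̃X(c)|² ≤ C(L)·ℓ⁻¹·Σ_p|curl X(p)|²`.  In PLAN B the defect is driven by ONE-STEP maps only; this file bounds each of them in `ℓ²` BY COUNTING, for every fine bond∕plaquette, the (cell, offset,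
run-step) triples that read it: (B1) `Σ_c ‖(L•QA)(c)‖² ≤ L^{2−d}·Σ_b ‖A b‖²` (`L^{d+1}` readings of weight `L^{−d}`, each fine bond read `L` times); (B2) `Σ_y ‖λ̄_A(y)‖² ≤ ((d+2)L)²·Σ_b ‖A b‖²`
(stairs of length `≤ (d+2)L` inside their block, lit ✓`blockOf_ends_of_mem_stairWalk`); (B3) `Σ_y ‖Φ(emb y)‖² ≤ Σ_x ‖Φ x‖²`; (B4) `Σ_c ‖g(c₊) − g(c₋)‖² ≤ 4d·Σ_y ‖g y‖²`; (B5) `Σ_{p′} ‖curl (L•QA)(p′)‖²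
≤ L^{4−d}·Σ_p ‖curl A(p)‖²` — abelian Stokes on the translated `L × L` squares (★p1 g18 ✓`LinAvgFluxExact.sum_bondAvg_plaq` ∘ ✓`rect_stokes`, w4 g8 ✓`Prop7TranslatedTubeFilling.plaqCirc_eq_curl`),
`L^{d+2}` unit plaquettes of weight `L^{−d}`, each fine plaquette read `L²` times — so the `j`-fold tube field `T_j = L^j•Q_jX` has curl energy `≤ L^{(4−d)j}·Σ|curl X|²` BY ITERATION; (B6) the curl
energy is translation invariant (the translate `X′ = X ∘ translate(−x₀)` of RULING №18).
WHAT IS PROVED (sorry-free, no definition; any `Params P`, standing range `j + 1 ≤ m + K`; `V` any real normed space, (B2) for `Matrix n n ℂ` in the `L2Operator` norm of lit `BlockAveragingEMLLinearised`):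
§0 `blockSite_pair_injective`, ★`tubeRead_injective`, ★`squareRead_injective`, `sum_comp_le_of_injective`; §1 `smul_bondAvg_eq`, ★★`sum_norm_sq_smul_bondAvg_le` (B1); §2
★★`sum_norm_sq_combMean_le` (B2); §3 ★`sum_norm_sq_comp_emb_le` (B3), ★`sum_norm_sq_coarseGrad_le` (B4); §4 `curl_smul`, `curl_bondAvg_eq_sum`, `curl_smul_bondAvg_eq_sum`,
★★★`sum_norm_sq_curl_smul_bondAvg_le` (B5); §5 `curl_comp_translate`, ★`sum_norm_sq_curl_translate` (B6).  HONEST FRAMING.  Elementary counting on the torus tower; no analysis beyond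
Cauchy–Schwarz; nothing of P1∕P2∕P3, the recursion knit P4-C, (I3′), COMB-FLAT-COERCIVITY, A6ᶜ, N06 or the crux K1 is proved or claimed.  Rung R3, not Clay; YM gap NOT proved.  `--supports … --as helper`.
References: T. Bałaban, CMP 95 (1984) 17–40 [Balaban1984PropagatorsI] ((1.8)–(1.11) p.19, (1.16)–(1.20) p.20); CMP 98 (1985) 17–51 [Balaban1985Averaging] ((62) p.28, (124)–(127) p.36);
CMP 99 (1985) 389–434 [Balaban1985BackgroundPropagators] ((3.14) p.393, Thm 3.11 p.416); CMP 109 (1987) 249–301 [Balaban1987RG1] ((0.3)–(0.4) pp.252–253).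
-/

noncomputable section
open scoped BigOperators

namespace Summit.QuantumFields.YangMills.Theorems.Prop7OneStepL2Bounds

open Literature.MathematicalPhysics.QuantumFieldTheory.Balaban1983to89
open T4Continuum BlockAveraging BlockAveragingEMLLinearised LatticeFieldCalculus
open Summit.QuantumFields.YangMills.Theorems.Prop7SliceBoundBookkeeping (norm_sq_sum_le_card_mul)
open Summit.QuantumFields.YangMills.Theorems.LinAvgFluxExact (rect_stokes sum_bondAvg_plaq)
open Summit.QuantumFields.YangMills.Theorems.Prop7TranslatedTubeFilling (plaqCirc_eq_curl)
open Summit.QuantumFields.YangMills.Theorems.Prop8Chart (norm_walkSum_le_of_steps norm_card_inv_smul_sum_le)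
variable {P : Params} {j : ℕ}

/-! ## §0 The reading maps: one tube step reads each fine bond `L` times, one square family each fine plaquette `L²` times -/
section Reading

/-- `(y, r) ↦ blockSite y r` is injective (standing range): a fine site determines its block and its offset. [cite: Balaban1987RG1, (0.3) p.252] -/
theorem blockSite_pair_injective (hj : j + 1 ≤ P.m + P.K) :
    Function.Injective fun yr : Site P (j + 1) × (Fin P.d → Fin P.L) => Site.blockSite yr.1 yr.2 := by
  rintro ⟨y, r⟩ ⟨y', r'⟩ h
  simp only at h
  have hy : y = y' := by
    rw [← Site.blockOf_blockSite hj y r, ← Site.blockOf_blockSite hj y' r', h]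
  subst hy
  have hr : r = r' := by
    funext μ
    apply Fin.ext
    have h1 := congrArg (fun z : Site P j => (z μ).val) h
    simp only [Site.val_blockSite hj] at h1; omega
  rw [hr]

/-- ★ At a FIXED run step `t`, the tube reading `(c, r) ↦ [blockSite c₋ r + t e_{dir c}, dir c]` is injective (so each fine bond is read `≤ L` times). [cite: Balaban1984PropagatorsI, (1.11) p.19] -/
theorem tubeRead_injective (hj : j + 1 ≤ P.m + P.K) (t : ℕ) :
    Function.Injective fun cr : PBond P (j + 1) × (Fin P.d → Fin P.L) => runBond (Site.blockSite cr.1.src cr.2) cr.1.dir t := by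
  have runSite_left_injective : ∀ (μ : Fin P.d) (t : ℕ), Function.Injective fun x : Site P j => runSite x μ t := by
    intro μ t x x' h
    funext ν
    have hν := congrFun h ν
    by_cases hνμ : ν = μ
    · subst hνμ
      simp only [runSite, Function.update_self] at hν
      exact add_right_cancel hν
    · simp only [runSite, Function.update_of_ne hνμ] at hν
      exact hν
  rintro ⟨c, r⟩ ⟨c', r'⟩ h
  simp only [runBond, PBond.mk.injEq] at h
  obtain ⟨h1, h2⟩ := h
  rw [h2] at h1
  have e1 : Site.blockSite c.src r = Site.blockSite c'.src r' := runSite_left_injective c'.dir t h1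
  have e2 : (c.src, r) = (c'.src, r') := blockSite_pair_injective hj e1
  simp only [Prod.mk.injEq] at e2
  obtain ⟨h4, h5⟩ := e2
  obtain ⟨cs, cd⟩ := c
  obtain ⟨cs', cd'⟩ := c'
  simp only at h2 h4 h5
  subst h2 h4 h5
  rfl

/-- ★ At FIXED run steps `(s, t)`, the square reading `(p′, r) ↦ □(blockSite p′₋ r + s e_μ + t e_ν; μ, ν)` is injective (each fine plaquette is read `≤ L²` times). [cite: Balaban1984PropagatorsI, (1.9) p.19] -/
theorem squareRead_injective (hj : j + 1 ≤ P.m + P.K) (s t : ℕ) :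
    Function.Injective fun pr : Plaq P (j + 1) × (Fin P.d → Fin P.L) =>
      (⟨runSite (runSite (Site.blockSite pr.1.src pr.2) pr.1.μ s) pr.1.ν t, pr.1.μ, pr.1.ν, pr.1.hμν⟩ : Plaq P j) := by
  have runSite_left_injective : ∀ (μ : Fin P.d) (t : ℕ), Function.Injective fun x : Site P j => runSite x μ t := by
    intro μ t x x' h
    funext ν
    have hν := congrFun h ν
    by_cases hνμ : ν = μ
    · subst hνμ
      simp only [runSite, Function.update_self] at hν
      exact add_right_cancel hν
    · simp only [runSite, Function.update_of_ne hνμ] at hν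
      exact hν
  rintro ⟨p, r⟩ ⟨p', r'⟩ h
  simp only [Plaq.mk.injEq] at h
  obtain ⟨h1, h2, h3⟩ := h
  rw [h2, h3] at h1
  have e0 : runSite (Site.blockSite p.src r) p'.μ s = runSite (Site.blockSite p'.src r') p'.μ s := runSite_left_injective p'.ν t h1
  have e1 : Site.blockSite p.src r = Site.blockSite p'.src r' := runSite_left_injective p'.μ s e0
  have e2 : (p.src, r) = (p'.src, r') := blockSite_pair_injective hj e1
  simp only [Prod.mk.injEq] at e2
  obtain ⟨h5, h6⟩ := e2
  obtain ⟨ps, pμ, pν, ph⟩ := p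
  obtain ⟨ps', pμ', pν', ph'⟩ := p'
  simp only at h2 h3 h5 h6
  subst h2 h3 h5 h6
  rfl

/-- Summing a non-negative function over the image of an injective reading is at most its full sum. [folklore] -/
theorem sum_comp_le_of_injective {α β : Type*} [Fintype α] [Fintype β] [DecidableEq β] (f : α → β) (hf : Function.Injective f)
    (g : β → ℝ) (hg : ∀ b, 0 ≤ g b) : ∑ a, g (f a) ≤ ∑ b, g b := by
  rw [← Finset.sum_image (f := g) (fun a _ a' _ h => hf h)]
  exact Finset.sum_le_univ_sum_of_nonneg hg
end Reading

/-! ## §1 (B1) The tube step contracts `ℓ²` by `L^{2−d}` -/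
section Tube
variable {V : Type*} [NormedAddCommGroup V] [NormedSpace ℝ V]

/-- `L•(QA)(c) = L^{−d}·Σ_r Σ_{t<L} A([blockSite c₋ r + t e_μ, μ])`. [cite: Balaban1984PropagatorsI, (1.11) p.19] -/
theorem smul_bondAvg_eq (A : VecField P j V) (c : PBond P (j + 1)) :
    (P.L : ℝ) • bondAvg A c = (((P.L : ℝ) ^ P.d)⁻¹) • ∑ r : Fin P.d → Fin P.L, ∑ t : Fin P.L, A (runBond (Site.blockSite c.src r) c.dir t) := by
  have hL : (P.L : ℝ) ≠ 0 := by exact_mod_cast P.L_pos.ne'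
  unfold bondAvg
  rw [smul_smul, show (P.L : ℝ) * ((P.L : ℝ) ^ (P.d + 1))⁻¹ = ((P.L : ℝ) ^ P.d)⁻¹ by rw [pow_succ]; field_simp]
  congr 1
  refine Finset.sum_congr rfl fun r _ => ?_
  rw [segSum, ← Fin.sum_univ_eq_sum_range]

/-- ★★ (B1) **THE TUBE STEP CONTRACTS `ℓ²` BY `L^{2−d}`**: `Σ_{c : level j+1} ‖L•(QA)(c)‖² ≤ (L²∕L^d)·Σ_{b : level j} ‖A b‖²` — `L^{d+1}` (offset, run-step) pairs of weight `L^{−d}`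
(Cauchy–Schwarz), and at each fixed run step the reading is injective (`tubeRead_injective`), so each fine bond is read `≤ L` times.  At d = 3: the factor `L⁻¹` of px22 PLAN B §6 ∕ the
`A`-recursion `‖A_{j+1}‖ ≤ L^{−1∕2}‖A_j‖ + ‖E_j‖`. [cite: Balaban1984PropagatorsI, (1.11) p.19, (1.18) p.20] -/
theorem sum_norm_sq_smul_bondAvg_le (hj : j + 1 ≤ P.m + P.K) (A : VecField P j V) :
    ∑ c : PBond P (j + 1), ‖(P.L : ℝ) • bondAvg A c‖ ^ 2 ≤ ((P.L : ℝ) ^ 2 / (P.L : ℝ) ^ P.d) * ∑ b : PBond P j, ‖A b‖ ^ 2 := by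
  have hL0 : (0 : ℝ) < P.L := by exact_mod_cast P.L_pos
  have hLd : (0 : ℝ) < (P.L : ℝ) ^ P.d := by positivity
  -- per coarse bond: Cauchy–Schwarz over the `L^d·L` readings (nested)
  have hper : ∀ c : PBond P (j + 1), ‖(P.L : ℝ) • bondAvg A c‖ ^ 2 ≤
      ((P.L : ℝ) / (P.L : ℝ) ^ P.d) * ∑ r : Fin P.d → Fin P.L, ∑ t : Fin P.L, ‖A (runBond (Site.blockSite c.src r) c.dir t)‖ ^ 2 := by
    intro c
    rw [smul_bondAvg_eq, norm_smul, mul_pow, norm_inv, norm_pow, Real.norm_natCast]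
    have h1 := norm_sq_sum_le_card_mul (Finset.univ : Finset (Fin P.d → Fin P.L))
      (fun r => ∑ t : Fin P.L, A (runBond (Site.blockSite c.src r) c.dir t))
    have h2 : ∀ r : Fin P.d → Fin P.L, ‖∑ t : Fin P.L, A (runBond (Site.blockSite c.src r) c.dir t)‖ ^ 2 ≤
        (P.L : ℝ) * ∑ t : Fin P.L, ‖A (runBond (Site.blockSite c.src r) c.dir t)‖ ^ 2 := by
      intro r
      have h := norm_sq_sum_le_card_mul (Finset.univ : Finset (Fin P.L)) (fun t => A (runBond (Site.blockSite c.src r) c.dir t))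
      rwa [Finset.card_univ, Fintype.card_fin] at h
    have hcard : ((Finset.univ : Finset (Fin P.d → Fin P.L)).card : ℝ) = (P.L : ℝ) ^ P.d := by
      rw [Finset.card_univ, Fintype.card_fun, Fintype.card_fin, Fintype.card_fin]; push_cast; ring
    rw [hcard] at h1
    have h3 : ‖∑ r : Fin P.d → Fin P.L, ∑ t : Fin P.L, A (runBond (Site.blockSite c.src r) c.dir t)‖ ^ 2 ≤
        (P.L : ℝ) ^ P.d * ((P.L : ℝ) * ∑ r : Fin P.d → Fin P.L, ∑ t : Fin P.L, ‖A (runBond (Site.blockSite c.src r) c.dir t)‖ ^ 2) := by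
      refine h1.trans ?_
      refine mul_le_mul_of_nonneg_left ?_ hLd.le
      rw [Finset.mul_sum]
      exact Finset.sum_le_sum fun r _ => h2 r
    calc (((P.L : ℝ) ^ P.d)⁻¹) ^ 2 * ‖∑ r : Fin P.d → Fin P.L, ∑ t : Fin P.L, A (runBond (Site.blockSite c.src r) c.dir t)‖ ^ 2
        ≤ (((P.L : ℝ) ^ P.d)⁻¹) ^ 2 * ((P.L : ℝ) ^ P.d * ((P.L : ℝ) * ∑ r : Fin P.d → Fin P.L, ∑ t : Fin P.L, ‖A (runBond (Site.blockSite c.src r) c.dir t)‖ ^ 2)) :=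
          mul_le_mul_of_nonneg_left h3 (by positivity)
      _ = ((P.L : ℝ) / (P.L : ℝ) ^ P.d) * ∑ r : Fin P.d → Fin P.L, ∑ t : Fin P.L, ‖A (runBond (Site.blockSite c.src r) c.dir t)‖ ^ 2 := by
          field_simp
  -- global: at each fixed run step the reading is injective, so each fine bond is read at most `L` times
  have hglob : ∑ c : PBond P (j + 1), ∑ r : Fin P.d → Fin P.L, ∑ t : Fin P.L, ‖A (runBond (Site.blockSite c.src r) c.dir t)‖ ^ 2 ≤ (P.L : ℝ) * ∑ b : PBond P j, ‖A b‖ ^ 2 := by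
    classical
    calc ∑ c : PBond P (j + 1), ∑ r : Fin P.d → Fin P.L, ∑ t : Fin P.L, ‖A (runBond (Site.blockSite c.src r) c.dir t)‖ ^ 2
        = ∑ c : PBond P (j + 1), ∑ t : Fin P.L, ∑ r : Fin P.d → Fin P.L, ‖A (runBond (Site.blockSite c.src r) c.dir t)‖ ^ 2 :=
          Finset.sum_congr rfl fun c _ => Finset.sum_comm
      _ = ∑ t : Fin P.L, ∑ c : PBond P (j + 1), ∑ r : Fin P.d → Fin P.L, ‖A (runBond (Site.blockSite c.src r) c.dir t)‖ ^ 2 :=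
          Finset.sum_comm
      _ = ∑ t : Fin P.L, ∑ cr : PBond P (j + 1) × (Fin P.d → Fin P.L), ‖A (runBond (Site.blockSite cr.1.src cr.2) cr.1.dir t)‖ ^ 2 := by
          refine Finset.sum_congr rfl fun t _ => ?_
          rw [Fintype.sum_prod_type]
      _ ≤ ∑ _t : Fin P.L, ∑ b : PBond P j, ‖A b‖ ^ 2 :=
          Finset.sum_le_sum fun t _ => sum_comp_le_of_injective _ (tubeRead_injective hj (t : ℕ)) (fun b => ‖A b‖ ^ 2) fun b => by positivity
      _ = (P.L : ℝ) * ∑ b : PBond P j, ‖A b‖ ^ 2 := by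
          rw [Finset.sum_const, Finset.card_univ, Fintype.card_fin, nsmul_eq_mul]
  calc ∑ c : PBond P (j + 1), ‖(P.L : ℝ) • bondAvg A c‖ ^ 2
      ≤ ∑ c : PBond P (j + 1), ((P.L : ℝ) / (P.L : ℝ) ^ P.d) * ∑ r : Fin P.d → Fin P.L, ∑ t : Fin P.L, ‖A (runBond (Site.blockSite c.src r) c.dir t)‖ ^ 2 :=
        Finset.sum_le_sum fun c _ => hper c
    _ = ((P.L : ℝ) / (P.L : ℝ) ^ P.d) * ∑ c : PBond P (j + 1), ∑ r : Fin P.d → Fin P.L, ∑ t : Fin P.L, ‖A (runBond (Site.blockSite c.src r) c.dir t)‖ ^ 2 := by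
        rw [Finset.mul_sum]
    _ ≤ ((P.L : ℝ) / (P.L : ℝ) ^ P.d) * ((P.L : ℝ) * ∑ b : PBond P j, ‖A b‖ ^ 2) := mul_le_mul_of_nonneg_left hglob (by positivity)
    _ = ((P.L : ℝ) ^ 2 / (P.L : ℝ) ^ P.d) * ∑ b : PBond P j, ‖A b‖ ^ 2 := by ring
end Tube

/-! ## §2 (B2) The block comb mean in `ℓ²` -/
section Comb
open scoped Matrix.Norms.L2Operator
variable {n : Type*} [Fintype n] [DecidableEq n] [Nonempty n]
omit [Nonempty n] in
/-- ★★ (B2) **THE BLOCK COMB MEAN IN `ℓ²`**: `Σ_{y : level j+1} ‖λ̄_A(y)‖² ≤ ((d+2)L)²·Σ_{b : level j} ‖A b‖²` — every staircase from the centre has `≤ (d+2)L` steps and stays inside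
its block (lit ✓`blockOf_ends_of_mem_stairWalk`), so `‖λ̄_A(y)‖ ≤ (d+2)L·(Σ_{b ⊂ B(y)}‖A b‖²)^{1∕2}`, and the blocks partition the bonds by `blockOf b₋`.  (The `Φ`-recursion's increment
`λ_j(A_j)` of px22's (A,Φ) split.) [cite: Balaban1985Averaging, (62) p.28; Balaban1987RG1, (0.3) p.252] -/
theorem sum_norm_sq_combMean_le (hj : j + 1 ≤ P.m + P.K) (A : PBond P j → Matrix n n ℂ) :
    ∑ y : Site P (j + 1), ‖combMean A y‖ ^ 2 ≤ ((((P.d + 2) * P.L : ℕ) : ℝ)) ^ 2 * ∑ b : PBond P j, ‖A b‖ ^ 2 := by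
  classical
  -- per block: every bond read by a staircase lies in the block, so it is bounded by the block's `ℓ²` mass
  have hper : ∀ y : Site P (j + 1), ‖combMean A y‖ ^ 2 ≤
      ((((P.d + 2) * P.L : ℕ) : ℝ)) ^ 2 * ∑ b ∈ Finset.univ.filter (fun b : PBond P j => blockOf b.src = y), ‖A b‖ ^ 2 := by
    intro y
    set S : ℝ := ∑ b ∈ Finset.univ.filter (fun b : PBond P j => blockOf b.src = y), ‖A b‖ ^ 2 with hS
    have hS0 : 0 ≤ S := Finset.sum_nonneg fun b _ => by positivity
    have hb : ∀ b : PBond P j, blockOf b.src = y → ‖A b‖ ≤ Real.sqrt S := by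
      intro b hby
      rw [← Real.sqrt_sq (norm_nonneg (A b))]
      refine Real.sqrt_le_sqrt ?_
      rw [hS]
      exact Finset.single_le_sum (f := fun b : PBond P j => ‖A b‖ ^ 2) (fun b _ => by positivity)
        (Finset.mem_filter.2 ⟨Finset.mem_univ _, hby⟩)
    have h1 : ‖combMean A y‖ ≤ ((((P.d + 2) * P.L : ℕ) : ℝ)) * Real.sqrt S := by
      rw [combMean_def]
      refine norm_card_inv_smul_sum_le (by positivity) fun i => ?_
      refine (norm_walkSum_le_of_steps A _ fun st hst => hb st.bond (blockOf_ends_of_mem_stairWalk hj y i.1 i.2.1 st hst).1).trans ?_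
      have hlen : ((walk (emb y) (stairWord i.2.1 (off i.1))).length : ℝ) ≤ ((((P.d + 2) * P.L : ℕ) : ℝ)) := by
        exact_mod_cast length_walk_stairWord_le (emb y) i.2.1 i.1
      exact mul_le_mul_of_nonneg_right hlen (Real.sqrt_nonneg _)
    calc ‖combMean A y‖ ^ 2 ≤ (((((P.d + 2) * P.L : ℕ) : ℝ)) * Real.sqrt S) ^ 2 := pow_le_pow_left₀ (norm_nonneg _) h1 2
      _ = ((((P.d + 2) * P.L : ℕ) : ℝ)) ^ 2 * S := by rw [mul_pow, Real.sq_sqrt hS0]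
  -- the blocks partition the bonds by `blockOf b.src`
  have hfib : ∑ y : Site P (j + 1), ∑ b ∈ Finset.univ.filter (fun b : PBond P j => blockOf b.src = y), ‖A b‖ ^ 2 = ∑ b : PBond P j, ‖A b‖ ^ 2 :=
    Finset.sum_fiberwise_of_maps_to (s := Finset.univ) (t := Finset.univ) (g := fun b : PBond P j => blockOf b.src)
      (fun b _ => Finset.mem_univ _) (fun b : PBond P j => ‖A b‖ ^ 2)
  calc ∑ y : Site P (j + 1), ‖combMean A y‖ ^ 2
      ≤ ∑ y : Site P (j + 1), ((((P.d + 2) * P.L : ℕ) : ℝ)) ^ 2 * ∑ b ∈ Finset.univ.filter (fun b : PBond P j => blockOf b.src = y), ‖A b‖ ^ 2 :=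
        Finset.sum_le_sum fun y _ => hper y
    _ = ((((P.d + 2) * P.L : ℕ) : ℝ)) ^ 2 * ∑ b : PBond P j, ‖A b‖ ^ 2 := by rw [← Finset.mul_sum, hfib]
end Comb

/-! ## §3 (B3) Centre sampling and (B4) the coarse gradient -/
section Sampling
variable {V : Type*} [NormedAddCommGroup V] [NormedSpace ℝ V]
omit [NormedSpace ℝ V] in
/-- ★ (B3) **CENTRE SAMPLING DOES NOT INCREASE `ℓ²`**: `Σ_{y : level j+1} ‖Φ(emb y)‖² ≤ Σ_{x : level j} ‖Φ x‖²` (`emb` is injective: `blockOf ∘ emb = id`).  (The `Φ`-recursion's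
transport `Φ_j ↦ Φ_j ∘ emb`.) [cite: Balaban1987RG1, (0.1) p.251] -/
theorem sum_norm_sq_comp_emb_le (hj : j + 1 ≤ P.m + P.K) (Φ : Site P j → V) :
    ∑ y : Site P (j + 1), ‖Φ (emb y)‖ ^ 2 ≤ ∑ x : Site P j, ‖Φ x‖ ^ 2 := by
  classical
  refine sum_comp_le_of_injective (fun y : Site P (j + 1) => emb y) (fun y y' h => ?_) (fun x => ‖Φ x‖ ^ 2) fun x => by positivity
  have h1 := congrArg blockOf h
  simpa only [Site.blockOf_emb hj] using h1

omit [NormedSpace ℝ V] in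
/-- ★ (B4) **THE COARSE GRADIENT IN `ℓ²`**: `Σ_{c : bonds} ‖g(c₊) − g(c₋)‖² ≤ 4d·Σ_{y : sites} ‖g y‖²` (every site is the source of `d` bonds and the target of `d` bonds).
(The last step `D = A_k + dΦ_k` of px22's (A,Φ) split.) [cite: Balaban1984PropagatorsI, (1.4) p.18] -/
theorem sum_norm_sq_coarseGrad_le {k : ℕ} (g : Site P k → V) :
    ∑ c : PBond P k, ‖g c.tgt - g c.src‖ ^ 2 ≤ 4 * (P.d : ℝ) * ∑ y : Site P k, ‖g y‖ ^ 2 := by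
  classical
  have shift_injective : ∀ μ : Fin P.d, Function.Injective fun x : Site P k => x.shift μ := fun μ x x' h => by
    simpa only [Site.unshift_shift] using congrArg (fun z : Site P k => z.unshift μ) h
  have h2 : ∀ c : PBond P k, ‖g c.tgt - g c.src‖ ^ 2 ≤ 2 * ‖g c.tgt‖ ^ 2 + 2 * ‖g c.src‖ ^ 2 := fun c => by
    have h := pow_le_pow_left₀ (norm_nonneg _) (norm_sub_le (g c.tgt) (g c.src)) 2
    nlinarith [sq_nonneg (‖g c.tgt‖ - ‖g c.src‖)]
  have hsrc : ∑ c : PBond P k, ‖g c.src‖ ^ 2 = (P.d : ℝ) * ∑ y : Site P k, ‖g y‖ ^ 2 := by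
    rw [← (LatticeFieldCalculus.bondEquiv (P := P) (j := k)).sum_comp (fun c : PBond P k => ‖g c.src‖ ^ 2), Fintype.sum_prod_type]
    simp only [LatticeFieldCalculus.bondEquiv, Equiv.coe_fn_mk, Finset.sum_const, Finset.card_univ, Fintype.card_fin, nsmul_eq_mul, Finset.mul_sum]
  have htgt : ∑ c : PBond P k, ‖g c.tgt‖ ^ 2 ≤ (P.d : ℝ) * ∑ y : Site P k, ‖g y‖ ^ 2 := by
    rw [← (LatticeFieldCalculus.bondEquiv (P := P) (j := k)).sum_comp (fun c : PBond P k => ‖g c.tgt‖ ^ 2), Fintype.sum_prod_type, Finset.sum_comm]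
    simp only [LatticeFieldCalculus.bondEquiv, Equiv.coe_fn_mk, PBond.tgt]
    calc ∑ μ : Fin P.d, ∑ x : Site P k, ‖g (x.shift μ)‖ ^ 2 ≤ ∑ _μ : Fin P.d, ∑ y : Site P k, ‖g y‖ ^ 2 :=
          Finset.sum_le_sum fun μ _ => sum_comp_le_of_injective _ (shift_injective μ) (fun y => ‖g y‖ ^ 2) fun y => by positivity
      _ = (P.d : ℝ) * ∑ y : Site P k, ‖g y‖ ^ 2 := by rw [Finset.sum_const, Finset.card_univ, Fintype.card_fin, nsmul_eq_mul]
  calc ∑ c : PBond P k, ‖g c.tgt - g c.src‖ ^ 2 ≤ ∑ c : PBond P k, (2 * ‖g c.tgt‖ ^ 2 + 2 * ‖g c.src‖ ^ 2) := Finset.sum_le_sum fun c _ => h2 c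
    _ = 2 * ∑ c : PBond P k, ‖g c.tgt‖ ^ 2 + 2 * ∑ c : PBond P k, ‖g c.src‖ ^ 2 := by
        rw [Finset.sum_add_distrib, Finset.mul_sum, Finset.mul_sum]
    _ ≤ 2 * ((P.d : ℝ) * ∑ y : Site P k, ‖g y‖ ^ 2) + 2 * ((P.d : ℝ) * ∑ y : Site P k, ‖g y‖ ^ 2) := by rw [hsrc]; linarith [htgt]
    _ = 4 * (P.d : ℝ) * ∑ y : Site P k, ‖g y‖ ^ 2 := by ring
end Sampling

/-! ## §4 (B5) The curl through ONE tube step -/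
section Curl
variable {V : Type*} [NormedAddCommGroup V] [NormedSpace ℝ V]

/-- `curl (a•B) = a•curl B`. [cite: Balaban1984PropagatorsI, (1.2) p.18] -/
theorem curl_smul {k : ℕ} (a : ℝ) (B : VecField P k V) (p : Plaq P k) : curl 1 (a • B) p = a • curl 1 B p := by
  simp only [curl, Pi.smul_apply, one_smul, smul_add, smul_sub]

/-- **THE CLOSED FORM**: `curl (QA)(y; μ, ν) = L^{−(d+1)}·Σ_r Σ_{s<L} Σ_{t<L} curl A(□(blockSite y r + s e_μ + t e_ν; μ, ν))` — the four block averages around the coarse plaquette are the block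
mean of the circulations around the translated `L × L` squares (✓`sum_bondAvg_plaq`), each a sum of unit plaquette circulations (✓`rect_stokes`, ✓`plaqCirc_eq_curl`).
[cite: Balaban1984PropagatorsI, (1.9) p.19, (1.11) p.19] -/
theorem curl_bondAvg_eq_sum (hj : j + 1 ≤ P.m + P.K) (A : VecField P j V) (p' : Plaq P (j + 1)) :
    curl 1 (bondAvg A) p' = (((P.L : ℝ) ^ (P.d + 1))⁻¹) • ∑ r : Fin P.d → Fin P.L, ∑ s : Fin P.L, ∑ t : Fin P.L,
      curl 1 A ⟨runSite (runSite (Site.blockSite p'.src r) p'.μ s) p'.ν t, p'.μ, p'.ν, p'.hμν⟩ := by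
  obtain ⟨y, μ, ν, h⟩ := p'
  rw [curl, one_smul]
  show bondAvg A ⟨y, μ⟩ + bondAvg A ⟨y.shift μ, ν⟩ - bondAvg A ⟨y.shift ν, μ⟩ - bondAvg A ⟨y, ν⟩ = _
  rw [sum_bondAvg_plaq hj A y μ ν]
  congr 1
  refine Finset.sum_congr rfl fun r _ => ?_
  rw [rect_stokes, ← Fin.sum_univ_eq_sum_range]
  refine Finset.sum_congr rfl fun s _ => ?_
  rw [← Fin.sum_univ_eq_sum_range]
  refine Finset.sum_congr rfl fun t _ => ?_
  exact plaqCirc_eq_curl A _ h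

/-- `curl (L•QA)(p′) = L^{−d}·Σ_r Σ_s Σ_t curl A(□(…))`. [cite: Balaban1984PropagatorsI, (1.9) p.19, (1.11) p.19] -/
theorem curl_smul_bondAvg_eq_sum (hj : j + 1 ≤ P.m + P.K) (A : VecField P j V) (p' : Plaq P (j + 1)) :
    curl 1 ((P.L : ℝ) • bondAvg A) p' = (((P.L : ℝ) ^ P.d)⁻¹) • ∑ r : Fin P.d → Fin P.L, ∑ s : Fin P.L, ∑ t : Fin P.L,
      curl 1 A ⟨runSite (runSite (Site.blockSite p'.src r) p'.μ s) p'.ν t, p'.μ, p'.ν, p'.hμν⟩ := by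
  have hL : (P.L : ℝ) ≠ 0 := by exact_mod_cast P.L_pos.ne'
  rw [curl_smul, curl_bondAvg_eq_sum hj, smul_smul, show (P.L : ℝ) * ((P.L : ℝ) ^ (P.d + 1))⁻¹ = ((P.L : ℝ) ^ P.d)⁻¹ by rw [pow_succ]; field_simp]

/-- ★★★ (B5) **THE CURL THROUGH ONE TUBE STEP COSTS `L^{4−d}`**: `Σ_{p′ : level j+1} ‖curl (L•QA)(p′)‖² ≤ (L⁴∕L^d)·Σ_{p : level j} ‖curl A(p)‖²` — `L^{d+2}` unit plaquettes of weight
`L^{−d}` (Cauchy–Schwarz), and at each fixed pair of run steps the reading is injective (`squareRead_injective`), so each fine plaquette is read `≤ L²` times.  ITERATED: the `j`-fold tube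
field `T_j = L^j•Q_jX` has `Σ‖curl T_j‖² ≤ L^{(4−d)j}·Σ‖curl X‖²` (`= L^j·…` at d = 3) — px22 PLAN B §5 with no `k`-fold closed form. [cite: Balaban1984PropagatorsI, (1.9) p.19, (1.18) p.20; Balaban1985Averaging, (9) p.19] -/
theorem sum_norm_sq_curl_smul_bondAvg_le (hj : j + 1 ≤ P.m + P.K) (A : VecField P j V) :
    ∑ p' : Plaq P (j + 1), ‖curl 1 ((P.L : ℝ) • bondAvg A) p'‖ ^ 2 ≤ ((P.L : ℝ) ^ 4 / (P.L : ℝ) ^ P.d) * ∑ p : Plaq P j, ‖curl 1 A p‖ ^ 2 := by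
  classical
  have hL0 : (0 : ℝ) < P.L := by exact_mod_cast P.L_pos
  have hLd : (0 : ℝ) < (P.L : ℝ) ^ P.d := by positivity
  -- abbreviation for the reading
  set π : Plaq P (j + 1) → (Fin P.d → Fin P.L) → Fin P.L → Fin P.L → Plaq P j :=
    fun p' r s t => ⟨runSite (runSite (Site.blockSite p'.src r) p'.μ s) p'.ν t, p'.μ, p'.ν, p'.hμν⟩ with hπ
  -- per coarse plaquette: nested Cauchy–Schwarz
  have hper : ∀ p' : Plaq P (j + 1), ‖curl 1 ((P.L : ℝ) • bondAvg A) p'‖ ^ 2 ≤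
      ((P.L : ℝ) ^ 2 / (P.L : ℝ) ^ P.d) * ∑ r : Fin P.d → Fin P.L, ∑ s : Fin P.L, ∑ t : Fin P.L, ‖curl 1 A (π p' r s t)‖ ^ 2 := by
    intro p'
    rw [curl_smul_bondAvg_eq_sum hj, norm_smul, mul_pow, norm_inv, norm_pow, Real.norm_natCast]
    -- flatten the triple reading sum and apply Cauchy–Schwarz once over the `L^d·L·L` readings
    have flatV : ∀ F : (Fin P.d → Fin P.L) → Fin P.L → Fin P.L → V,
        ∑ r, ∑ s, ∑ t, F r s t = ∑ x : (Fin P.d → Fin P.L) × Fin P.L × Fin P.L, F x.1 x.2.1 x.2.2 := fun F => by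
      rw [Fintype.sum_prod_type]
      exact Finset.sum_congr rfl fun r _ => by rw [Fintype.sum_prod_type]
    have flatR : ∀ F : (Fin P.d → Fin P.L) → Fin P.L → Fin P.L → ℝ,
        ∑ r, ∑ s, ∑ t, F r s t = ∑ x : (Fin P.d → Fin P.L) × Fin P.L × Fin P.L, F x.1 x.2.1 x.2.2 := fun F => by
      rw [Fintype.sum_prod_type]
      exact Finset.sum_congr rfl fun r _ => by rw [Fintype.sum_prod_type]
    have hπ' : ∀ (r : Fin P.d → Fin P.L) (s t : Fin P.L),
        (⟨runSite (runSite (Site.blockSite p'.src r) p'.μ s) p'.ν t, p'.μ, p'.ν, p'.hμν⟩ : Plaq P j) = π p' r s t := fun r s t => rfl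
    simp only [hπ']
    rw [flatV, flatR (fun r s t => ‖curl 1 A (π p' r s t)‖ ^ 2)]
    have hcs := norm_sq_sum_le_card_mul (Finset.univ : Finset ((Fin P.d → Fin P.L) × Fin P.L × Fin P.L)) (fun x => curl 1 A (π p' x.1 x.2.1 x.2.2))
    have hcard : ((Finset.univ : Finset ((Fin P.d → Fin P.L) × Fin P.L × Fin P.L)).card : ℝ) = (P.L : ℝ) ^ P.d * ((P.L : ℝ) * P.L) := by
      rw [Finset.card_univ, Fintype.card_prod, Fintype.card_prod, Fintype.card_fun, Fintype.card_fin, Fintype.card_fin]; push_cast; ring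
    rw [hcard] at hcs
    calc (((P.L : ℝ) ^ P.d)⁻¹) ^ 2 * ‖∑ x : (Fin P.d → Fin P.L) × Fin P.L × Fin P.L, curl 1 A (π p' x.1 x.2.1 x.2.2)‖ ^ 2
        ≤ (((P.L : ℝ) ^ P.d)⁻¹) ^ 2 * ((P.L : ℝ) ^ P.d * ((P.L : ℝ) * P.L) * ∑ x : (Fin P.d → Fin P.L) × Fin P.L × Fin P.L, ‖curl 1 A (π p' x.1 x.2.1 x.2.2)‖ ^ 2) :=
          mul_le_mul_of_nonneg_left hcs (by positivity)
      _ = ((P.L : ℝ) ^ 2 / (P.L : ℝ) ^ P.d) * ∑ x : (Fin P.d → Fin P.L) × Fin P.L × Fin P.L, ‖curl 1 A (π p' x.1 x.2.1 x.2.2)‖ ^ 2 := by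
          field_simp
  -- global: at each fixed `(s, t)` the reading `(p′, r) ↦ π p′ r s t` is injective
  have hglob : ∑ p' : Plaq P (j + 1), ∑ r : Fin P.d → Fin P.L, ∑ s : Fin P.L, ∑ t : Fin P.L, ‖curl 1 A (π p' r s t)‖ ^ 2 ≤
      (P.L : ℝ) ^ 2 * ∑ p : Plaq P j, ‖curl 1 A p‖ ^ 2 := by
    calc ∑ p' : Plaq P (j + 1), ∑ r : Fin P.d → Fin P.L, ∑ s : Fin P.L, ∑ t : Fin P.L, ‖curl 1 A (π p' r s t)‖ ^ 2
        = ∑ p' : Plaq P (j + 1), ∑ s : Fin P.L, ∑ t : Fin P.L, ∑ r : Fin P.d → Fin P.L, ‖curl 1 A (π p' r s t)‖ ^ 2 := by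
          refine Finset.sum_congr rfl fun p' _ => ?_
          rw [Finset.sum_comm]
          exact Finset.sum_congr rfl fun s _ => Finset.sum_comm
      _ = ∑ s : Fin P.L, ∑ t : Fin P.L, ∑ p' : Plaq P (j + 1), ∑ r : Fin P.d → Fin P.L, ‖curl 1 A (π p' r s t)‖ ^ 2 := by
          rw [Finset.sum_comm]
          exact Finset.sum_congr rfl fun s _ => Finset.sum_comm
      _ = ∑ s : Fin P.L, ∑ t : Fin P.L, ∑ pr : Plaq P (j + 1) × (Fin P.d → Fin P.L), ‖curl 1 A (π pr.1 pr.2 s t)‖ ^ 2 := by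
          refine Finset.sum_congr rfl fun s _ => Finset.sum_congr rfl fun t _ => ?_
          rw [Fintype.sum_prod_type]
      _ ≤ ∑ _s : Fin P.L, ∑ _t : Fin P.L, ∑ p : Plaq P j, ‖curl 1 A p‖ ^ 2 :=
          Finset.sum_le_sum fun s _ => Finset.sum_le_sum fun t _ =>
            sum_comp_le_of_injective (fun pr : Plaq P (j + 1) × (Fin P.d → Fin P.L) => π pr.1 pr.2 s t)
              (squareRead_injective hj (s : ℕ) (t : ℕ)) (fun p => ‖curl 1 A p‖ ^ 2) fun p => by positivity
      _ = (P.L : ℝ) ^ 2 * ∑ p : Plaq P j, ‖curl 1 A p‖ ^ 2 := by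
          rw [Finset.sum_const, Finset.card_univ, Fintype.card_fin, nsmul_eq_mul, Finset.sum_const, Finset.card_univ, Fintype.card_fin, nsmul_eq_mul]
          ring
  calc ∑ p' : Plaq P (j + 1), ‖curl 1 ((P.L : ℝ) • bondAvg A) p'‖ ^ 2
      ≤ ∑ p' : Plaq P (j + 1), ((P.L : ℝ) ^ 2 / (P.L : ℝ) ^ P.d) * ∑ r : Fin P.d → Fin P.L, ∑ s : Fin P.L, ∑ t : Fin P.L, ‖curl 1 A (π p' r s t)‖ ^ 2 :=
        Finset.sum_le_sum fun p' _ => hper p'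
    _ = ((P.L : ℝ) ^ 2 / (P.L : ℝ) ^ P.d) * ∑ p' : Plaq P (j + 1), ∑ r : Fin P.d → Fin P.L, ∑ s : Fin P.L, ∑ t : Fin P.L, ‖curl 1 A (π p' r s t)‖ ^ 2 := by
        rw [Finset.mul_sum]
    _ ≤ ((P.L : ℝ) ^ 2 / (P.L : ℝ) ^ P.d) * ((P.L : ℝ) ^ 2 * ∑ p : Plaq P j, ‖curl 1 A p‖ ^ 2) := mul_le_mul_of_nonneg_left hglob (by positivity)
    _ = ((P.L : ℝ) ^ 4 / (P.L : ℝ) ^ P.d) * ∑ p : Plaq P j, ‖curl 1 A p‖ ^ 2 := by ring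
end Curl

/-! ## §5 (B6) Translation invariance of the curl energy -/
section Translate
variable {V : Type*} [NormedAddCommGroup V] [NormedSpace ℝ V]

/-- `curl (X ∘ τ_v)(p) = curl X(p + v)`. [cite: Balaban1984PropagatorsI, (1.2) p.18] -/
theorem curl_comp_translate {k : ℕ} (v : Site P k) (X : VecField P k V) (p : Plaq P k) :
    curl 1 (fun b => X (b.translate v)) p = curl 1 X (p.translate v) := by
  simp only [curl, PBond.translate, Plaq.translate, Site.shift_add]

/-- ★ (B6) **THE CURL ENERGY IS TRANSLATION INVARIANT**: `Σ_p ‖curl (X ∘ τ_v)(p)‖² = Σ_p ‖curl X(p)‖²` — for the translate `X′ = X ∘ translate(−x₀)` of ★★OWNER RULING №18 (2) the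
right side of the slice bound is the curl energy of `X` itself. [cite: Balaban1984PropagatorsI, (1.2) p.18] -/
theorem sum_norm_sq_curl_translate {k : ℕ} (v : Site P k) (X : VecField P k V) :
    ∑ p : Plaq P k, ‖curl 1 (fun b => X (b.translate v)) p‖ ^ 2 = ∑ p : Plaq P k, ‖curl 1 X p‖ ^ 2 := by
  simp only [curl_comp_translate]
  exact (Plaq.translateEquiv v).sum_comp (fun p => ‖curl 1 X p‖ ^ 2)
end Translate

end Summit.QuantumFields.YangMills.Theorems.Prop7OneStepL2Bounds
end
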